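/-
Copyright (c) 2026. All rights reserved.
Released under Apache 2.0 license as described in the file LICENSE.
Authors: abc-iut cell, campaign-S prover seat abc-iut-S1 (wave 1).
-/
import Mathlib.RingTheory.DedekindDomain.Different
import Mathlib.NumberTheory.Padics.PadicIntegers
import Mathlib.Analysis.SpecialFunctions.Log.Base
import Mathlib.Analysis.Normed.Module.Basic
import Literature.NumberTheory.GaloisRepresentations.UniformizerResidueIndex
import HarnessLib

/-!
# The ring of integers `R = 𝒪_K` of a mixed-characteristic local field as a `ℤ_p`-algebra; the different

Mochizuki, *Inter-universal Teichmüller theory IV*, RIMS manuscript (Apr. 2020), §1, Proposition 1.1,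
kurims p. 9: "Write `R ⊆ ℚ̄_p` for the ring of integers of `ℚ̄_p` … let `k_i ⊆ ℚ̄_p` be a finite
extension of `ℚ_p`; write `R_i := 𝒪_{k_i} = R ∩ k_i` for the ring of integers of `k_i` and `d_i ∈ ℚ_{≥0}`
for the order [i.e., "`ord(−)`"] of any generator of the different ideal of `R_i` over `ℤ_p`"; and the
tensor products "`R_E := ⊗_{i∈E} R_i` — where the tensor product is over `ℤ_p`".

## Setting and contents (definitions + proved API; no named fact)

Norm-side MLF setting of the cell (`LocalUnitLog.lean`, `RamificationInvariants.lean`): `K` a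
nontrivially normed field, normed `ℚ_p`-algebra, ultrametric, proper.  `R = 𝒪_K` is the tree's
valuation ring `Valued.integer K = {‖x‖ ≤ 1}` of the norm-induced valuation (scoped instance
`NormedField.toValued`, as in `NormUniformizer.lean` / `UniformizerResidueIndex.lean`).

* `integerHom p K : ℤ_[p] →+* 𝒪_K` (the structure map `ℤ_p ⊆ ℚ_p → K` lands in `{‖x‖ ≤ 1}`) and the
  SCOPED instance `Algebra ℤ_[p] (Valued.integer K)` (scoped to `Literature.IUT.LogVolume`; it is "the
  tensor product is over `ℤ_p`" of Prop. 1.1); `algebraMap_integer_injective`; scoped instances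
  `IsDiscreteValuationRing 𝒪_K` (the tree's `Ultrametric.isDiscreteValuationRing_integer`) and
  `Module.IsTorsionFree ℤ_[p] 𝒪_K`.
* `different p K : Ideal 𝒪_K` — the different ideal of `𝒪_K` over `ℤ_p`, AS Mathlib's `differentIdeal`
  (inverse of the trace dual); `differentOrd p K = d` — "the order of any generator of the different
  ideal" as the real number `−log_p` of the largest norm attained on `𝔇` (`= ‖g‖` for any generator
  `g`, `norm_le_of_mem_span_singleton`, `differentOrd_eq_of_span`).

NOT here: `d ∈ (1/e)ℤ_{≥0}` and `𝔇 ≠ 0` (need `Module.Finite ℤ_p 𝒪_K`), the estimates of the different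
(Prop. 1.3, `DifferentEstimates.lean`), tensor products `R_I` (Prop. 1.1, `TensorPacketRing.lean`).
Classical (Serre, *Local Fields*, Ch. III); the [IUTchIV] locators record the cell's typing.
-/

noncomputable section

open Metric Set IsLocalRing
open scoped NormedField

namespace Literature.IUT.LogVolume

open Literature.NumberTheory.GaloisRepresentations.Ultrametric

variable (p : ℕ) [Fact p.Prime]
variable (K : Type*) [NontriviallyNormedField K] [instK : NormedAlgebra ℚ_[p] K] [IsUltrametricDist K]

/-! ## `𝒪_K` as a `ℤ_p`-algebra -/

omit [IsUltrametricDist K] in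
/-- The structure map `ℤ_p → ℚ_p → K` takes values in `R = 𝒪_K = {‖x‖ ≤ 1}` (`‖x‖_K = ‖x‖_p ≤ 1`).
[claim: Mochizuki2012, status: disputed] -/
theorem norm_algebraMap_padicInt_le_one (x : ℤ_[p]) : ‖algebraMap ℚ_[p] K (x : ℚ_[p])‖ ≤ 1 := by
  rw [norm_algebraMap']
  exact x.2

/-- **`ℤ_p → R = 𝒪_K`**, the structure map of the ring of integers as a `ℤ_p`-algebra ("the tensor
product is over `ℤ_p`", [IUTchIV] Prop. 1.1, p. 9). [claim: Mochizuki2012, status: disputed] -/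
def integerHom : ℤ_[p] →+* Valued.integer K :=
  ((algebraMap ℚ_[p] K).comp (algebraMap ℤ_[p] ℚ_[p])).codRestrict (Valued.integer K) fun x ↦
    Valued.integer.mem_iff.mpr (by
      rw [RingHom.comp_apply, PadicInt.algebraMap_apply]
      exact norm_algebraMap_padicInt_le_one p K x)

/-- The structure map on underlying elements: `ℤ_p ∋ x ↦ x ∈ K`. [claim: Mochizuki2012, status: disputed] -/
@[simp] theorem coe_integerHom (x : ℤ_[p]) :
    ((integerHom p K x : Valued.integer K) : K) = algebraMap ℚ_[p] K (x : ℚ_[p]) := rfl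

/-- `ℤ_p → 𝒪_K` is injective. [claim: Mochizuki2012, status: disputed] -/
theorem integerHom_injective : Function.Injective (integerHom p K) := by
  intro x y h
  have h' := congrArg (fun z : Valued.integer K ↦ (z : K)) h
  simp only [coe_integerHom] at h'
  exact PadicInt.ext ((algebraMap ℚ_[p] K).injective h')

/-- **`R = 𝒪_K` as a `ℤ_p`-algebra** (scoped instance of the namespace `Literature.IUT.LogVolume`).
[claim: Mochizuki2012, status: disputed] -/
scoped instance algebraPadicInt : Algebra ℤ_[p] (Valued.integer K) := (integerHom p K).toAlgebra

/-- The algebra map IS `integerHom`. [claim: Mochizuki2012, status: disputed] -/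
theorem algebraMap_integer_eq : algebraMap ℤ_[p] (Valued.integer K) = integerHom p K := rfl

/-- `algebraMap ℤ_p 𝒪_K` is injective. [claim: Mochizuki2012, status: disputed] -/
theorem algebraMap_integer_injective : Function.Injective (algebraMap ℤ_[p] (Valued.integer K)) :=
  integerHom_injective p K

/-- **`𝒪_K` is a discrete valuation ring** for a proper `K` (the tree's
`Ultrametric.isDiscreteValuationRing_integer`, as a scoped instance so that Mathlib's Dedekind-domain API
— in particular `differentIdeal` — applies to `R`). [claim: Mochizuki2012, status: disputed] -/
scoped instance isDiscreteValuationRing_integer [ProperSpace K] :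
    IsDiscreteValuationRing (Valued.integer K) :=
  Literature.NumberTheory.GaloisRepresentations.Ultrametric.isDiscreteValuationRing_integer

omit instK in
/-- `𝒪_K` is an integral domain (a subring of a field). [claim: Mochizuki2012, status: disputed] -/
theorem isDomain_integer : IsDomain (Valued.integer K) := inferInstance

/-- **`𝒪_K` is torsion-free over `ℤ_p`** (injective structure map between domains).
[claim: Mochizuki2012, status: disputed] -/
scoped instance isTorsionFree_integer : Module.IsTorsionFree ℤ_[p] (Valued.integer K) :=
  Module.isTorsionFree_iff_algebraMap_injective.mpr (algebraMap_integer_injective p K)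

/-! ## The different `𝔇` and its order `d` -/

/-- **The different ideal of `R = 𝒪_K` over `ℤ_p`** ([IUTchIV] Prop. 1.1, p. 9), as Mathlib's
`differentIdeal ℤ_[p] 𝒪_K` (the ideal whose inverse is the dual of `𝒪_K` for the trace form of
`K/ℚ_p`). [claim: Mochizuki2012, status: disputed] -/
def different [ProperSpace K] : Ideal (Valued.integer K) := differentIdeal ℤ_[p] (Valued.integer K)

/-- `𝔇` unfolds to Mathlib's `differentIdeal`. [claim: Mochizuki2012, status: disputed] -/
theorem different_eq [ProperSpace K] : different p K = differentIdeal ℤ_[p] (Valued.integer K) := rfl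

/-- The set of norms `‖x‖`, `x ∈ 𝔇` (its supremum is the norm of any generator).
[claim: Mochizuki2012, status: disputed] -/
def differentNorms [ProperSpace K] : Set ℝ :=
  (fun x : Valued.integer K ↦ ‖(x : K)‖) '' (different p K : Set (Valued.integer K))

/-- **`d`, "the order `ord(−)` of any generator of the different ideal of `R` over `ℤ_p`"**
([IUTchIV] Prop. 1.1, p. 9), as a real number: `d := −log_p (sup_{x ∈ 𝔇} ‖x‖)`; for a generator `g`
of the (principal) ideal `𝔇` this is `−log_p ‖g‖ = ord(g)` (`differentOrd_eq_of_span`).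
[claim: Mochizuki2012, status: disputed] -/
def differentOrd [ProperSpace K] : ℝ := -Real.logb p (sSup (differentNorms p K))

omit instK in
/-- In a principal ideal `(g)` of `𝒪_K` every element has norm `≤ ‖g‖`.
[claim: Mochizuki2012, status: disputed] -/
theorem norm_le_of_mem_span_singleton {g x : Valued.integer K} (hx : x ∈ Ideal.span {g}) :
    ‖(x : K)‖ ≤ ‖(g : K)‖ := by
  obtain ⟨y, rfl⟩ := Ideal.mem_span_singleton'.mp hx
  push_cast
  rw [norm_mul]
  calc ‖(y : K)‖ * ‖(g : K)‖ ≤ 1 * ‖(g : K)‖ := by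
        gcongr; exact Valued.integer.norm_le_one y
    _ = ‖(g : K)‖ := one_mul _

omit instK in
/-- The supremum of the norms on a principal ideal `(g)` is `‖g‖`. [claim: Mochizuki2012, status: disputed] -/
theorem sSup_norm_image_span_singleton (g : Valued.integer K) :
    sSup ((fun x : Valued.integer K ↦ ‖(x : K)‖) '' (Ideal.span {g} : Set (Valued.integer K))) =
      ‖(g : K)‖ := by
  apply le_antisymm
  · refine csSup_le ⟨_, ⟨g, Ideal.mem_span_singleton_self g, rfl⟩⟩ ?_
    rintro _ ⟨x, hx, rfl⟩
    exact norm_le_of_mem_span_singleton K hx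
  · refine le_csSup ⟨‖(g : K)‖, ?_⟩ ⟨g, Ideal.mem_span_singleton_self g, rfl⟩
    rintro _ ⟨x, hx, rfl⟩
    exact norm_le_of_mem_span_singleton K hx

/-- **`d = ord(g) = −log_p ‖g‖` for ANY generator `g` of `𝔇`** ("the order of any generator").
[claim: Mochizuki2012, status: disputed] -/
theorem differentOrd_eq_of_span [ProperSpace K] {g : Valued.integer K}
    (hg : different p K = Ideal.span {g}) : differentOrd p K = -Real.logb p ‖(g : K)‖ := by
  rw [differentOrd, differentNorms, hg, sSup_norm_image_span_singleton]

/-- `𝔇` is principal (`𝒪_K` is a discrete valuation ring): a generator exists.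
[claim: Mochizuki2012, status: disputed] -/
theorem exists_different_eq_span [ProperSpace K] :
    ∃ g : Valued.integer K, different p K = Ideal.span {g} :=
  ⟨_, (IsPrincipalIdealRing.principal (different p K)).span_singleton_generator.symm⟩

/-- `‖g‖ = p^{−d}` for any generator `g ≠ 0` of `𝔇` (`ord(g) = d`). [claim: Mochizuki2012, status: disputed] -/
theorem norm_eq_rpow_neg_differentOrd [ProperSpace K] {g : Valued.integer K}
    (hg : different p K = Ideal.span {g}) (hg0 : g ≠ 0) :
    ‖(g : K)‖ = (p : ℝ) ^ (-differentOrd p K) := by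
  have hp1 : (1 : ℝ) < p := by exact_mod_cast (Fact.out : p.Prime).one_lt
  have hn : 0 < ‖(g : K)‖ := norm_pos_iff.mpr (by exact_mod_cast hg0)
  rw [differentOrd_eq_of_span p K hg, neg_neg, Real.rpow_logb (by linarith) hp1.ne' hn]

end Literature.IUT.LogVolume

end
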